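import Summits.QuantumFields.BalabanUV.Beta.FP.SymDressingUnits
import Summits.QuantumFields.BalabanUV.Beta.SymmetrisedStepJets
import Summits.QuantumFields.BalabanUV.Beta.FP.SymmetryKHolds

/-!
# `BalabanUV.Beta.FP.KPerfSymHolds` — road «FP» for binder row D1, RULING R-FP-40 (R40-b)∕(A5) row #16 «KPERF-SYM», COMPANION to the owner's
# `FP/SymDressingUnits` (p255020 ✓, «m = 1 ✓⊙ by type modulo (CONV-C) rate data»): THE ROW IS UNCONDITIONAL IN DIMENSION FOUR — the K-slot of (CONV-C)
# is gan24's THEOREM `KSlotAssembly.convCKWall_holds : 2 ≤ Lc → ConvCKWall 3 Lc`, so for every `Lc ≥ 2` and every root `ρ`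
# `limMKerOf (j ↦ unitK_j (coDressKSymAt ρ Lc (KInvStep Lc j))) = coDressKSymAt ρ Lc (KPerf Lc (sfStep Lc) (smStep 3 Lc) 1)` — at an2's centred family:
# `G^s_1 := limMKerOf (j ↦ unitK_j (Gsym Lc j)) = coDressKSymAt (ctr 4 Lc) Lc (KPerf … 1)` — with NO hypothesis; plus the letter-free finite-window route
# (entrywise limits pass through the co-dressing for ANY convergent family, any root) and the co-dressed family's K-rows `hK`∕`hKall` (Cauchy currency)

HONEST DEPENDENCY (page 1, mandatory): continuum YM on T⁴ ⇐ BetaPertH ∧ nine spine estimates (0/9 proved); BetaPertH ⇐ (D1) ∧ (D4) ∧ CAP+tail;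
G-an2-4 gates asym, D1 and NE2/3/4.  HONEST FRAMING (cell contract, verbatim): «discharging `BetaPertH` makes Bałaban's UV stability UNCONDITIONAL —
a real constructive-QFT result; it is NOT the continuum limit and NOT the Clay problem.»  THIS MODULE DISCHARGES NOTHING of the wall: it is [folklore]
kernel bookkeeping — the symmetrised block-mean projector kernel `piKSymBm ρ N` (an2, `SymmetrisedDressingKernel`) has a FINITE WINDOW on the field block and is
the identity on the multiplier block, so every entry of `coDressKSymAt ρ N K` is a finite double window sum of entries of `K` and entrywise limits pass through
it with NO decay or summability letter and NO in-block-root condition — plus [our object] INSTANCES at tree theorems BY NAME: the owner's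
`SymDressingUnits.coDressKSymAt_unitK`∕`coDressKSymAt_sub`∕`decays_coDressKSymAt_explicit`∕`limMKerOf_coDressKSymAt_unitK_eq`, the lineage's
`SymmetryKHolds.tendsto_KStepUnit_KPerf_one`∕`decays_KPerf_one_holds`, gan24's `KSlotAssembly.convCKWall_holds`, asym1's `HessKerDressedLimit` closure lemmas.
No `def`, no `def … : Prop`, nothing cited, 0 sorry; 0∕4 row-D1 binders; (A5): row #16 is the LEFT↔RIGHT dictionary at the resolvent, OPTIONAL for the
critical path of the LEFT placement of record; NOT COL-SYM (#15, VOID), NOT STEP-SYM (#17), NOT WALL-SYM′ (#18, Q-R40-2′), NOT (ASYMP), NOT D1, NOT BetaPertH,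
NOT continuum, NOT Clay.  «not in print; our bookkeeping».

ABSOLUTE RULE (cell charter, verbatim): «No internally-minted statement may enter as a cited fact. Every hypothesis is either kernel-proved in this package or a
verbatim quotation of a PUBLISHED theorem with page reference. The manuscript(s) under audit are NOT citable for their own disputed steps — they are the thing
under adjudication; programme-internal (2001/route/tribunal) claims are never citable.»

WHAT.  §1 [folklore] (any `d`, root `ρ`, blocking `N`; NO letter on `K`) the finite-window readings of the two factors of the co-dressing, leg by leg:
`comp_trK_piKSymBm_inr`∕`_inl` (left factor), `comp_piKSymBm_inl` (right factor, field column; the multiplier column is an2's `comp_piKSymBm_inr`), hence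
**`tendsto_coDressKSymAt`** (entrywise limits pass through the co-dressing) and **`limMKerOf_coDressKSymAt`**∕**`limMKerOf_coDressKSymAt_lim`**
(`limMKerOf (j ↦ coDressKSymAt ρ N (K j)) = coDressKSymAt ρ N L = coDressKSymAt ρ N (limMKerOf K)` for any entrywise limit `L` — the letter-free twin of the
owner's `limMKerOf_coDressKSymAt_eq`, which asks `Decays`-rate data and an in-block root).  §2 [folklore] (in-block root `toSite r`) `exists_decays_coDressKSymAt_uniform`
(the owner's displayed constant repackaged as `∃ c(d,N,δ) ≥ 0, ∀ K C, Decays K C δ → Decays (coDressKSymAt (toSite r) N K) (c·C) (δ/4)`), `exists_coDressedSym_rows`,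
**`exists_coDressedSym_unit_rows`** (CAUCHY currency: `j`-uniform rows + ALL-SCALES deviations `hKall` of `D_j K_j D_j` ⟹ those of `D_j (coDressKSymAt (toSite r) N K_j) D_j`
at `(c·C, δ/4, c·c_K, θ)` — the owner's §3 is the rate-to-a-named-limit currency; sym twin of asym1's `HessKerCoDressedBmWall.exists_coDressedBm_unit_rows`).
§3 [our object] `d = 3`, `2 ≤ Lc`, UNCONDITIONAL: for EVERY root `ρ`, **`tendsto_unitK_coDressKSymAt_KInvStep`** and **`limMKerOf_unitK_coDressKSymAt_KInvStep`**;
at an2's centred family `Gsym Lc j = coDressKSymAt (ctr 4 Lc) Lc (KInvStep Lc j)` (`SymmetrisedStepJets`): **`limMKerOf_unitK_Gsym`** (THE ROW: `G^s_1` NAMED as the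
constructed limit and IDENTIFIED with `coDressKSymAt (ctr 4 Lc) Lc (KPerf … 1)` — a theorem, no new `def`), `tendsto_unitK_Gsym`; the SAME identity re-derived through
the OWNER's route **`limMKerOf_unitK_coDressKSymAt_KInvStep_of_owner`** (his `limMKerOf_coDressKSymAt_unitK_eq` with ALL FOUR data discharged by `convCKWall_holds` +
asym1's `decays_limMKerOf`∕`decays_sub_limMKerOf` — the two routes agree BY NAME); **`kSlotSym_holds`**∕**`kSlotSym_ctr_holds`** (the co-dressed unit family's rows
`hK`∕`hKall`, in-block ∕ centred root), **`decays_unitK_Gsym_sub_holds`** (geometric `Decays`-rate of the unit co-dressed family to `coDressKSymAt (ctr 4 Lc) Lc (KPerf … 1)`,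
SAME constant as `hKall`) and **`exists_decays_coDressKSymAt_KPerf_one`** (the co-dressed perfect one-step resolvent decays).  For `m ≥ 2` the object is the
composite's ((X1m-sym) ∕ STEP-SYM #17 — NOT here; §1 is stated for ANY blocking and ANY convergent family).
Provenance: D1 formalisation swarm LEAF PROVER 06, unit b2b-balaban-beta-d1-formalise-leaf-06 gen 11 (prover-b2b-balaban-beta-d1-formalise-leaf-06-g11-0),
2026-08-21, companion to the road-FP owner's R-FP-40 row #16 module (INTENT l.28881 crossed by p255020 l.28874 — reshaped as the instance∕discharge file l.28957;
owner «GO, THIS SHAPE» l.28995);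
over the owner's `FP.SymDressingUnits`, an2's `SymmetrisedDressingKernel`∕`SymmetrisedStepJets`, the lineage's `FP.SymmetryKHolds`, gan24's `GAN24.KSlotAssembly`,
asym1's `HessKerDressedLimit` BY NAME (pattern: asym1's `HessKerCoDressedBmWall` §2); no existing file touched, nothing restated.
-/

noncomputable section

namespace Summit.QuantumFields.BalabanUV.Beta.FP.KPerfSymHolds

open Finset Filter Topology
open scoped BigOperators
open Literature.MathematicalPhysics.QuantumFieldTheory
open Literature.MathematicalPhysics.QuantumFieldTheory.Balaban1983to89
open Literature.MathematicalPhysics.QuantumFieldTheory.Balaban1983to89.Beta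
open ExpKernelCalculus (MKer Decays comp Zl Zl_nonneg)
open AffineAveraging (box toSite)
open AveragingContoursRooted (ctr ctrOff ctrOff_mem_box)
open OneStepResolventKernel (Fib)
open OneStepKernelFamily (KInvStep)
open HessKerDressedLimit (limMKerOf limMKerOf_eq_of_tendsto decays_limMKerOf decays_sub_limMKerOf)
open Summit.QuantumFields.BalabanUV.Beta.TameKernelCalculus (trK trK_apply)
open Summit.QuantumFields.BalabanUV.Beta.HessKerDressedUnits (unitK)
open Summit.QuantumFields.BalabanUV.Beta.AxialDressingRooted (cube cPb cPb_nonneg tsum_window' tsum_point' one_le_of_neZero)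
open Summit.QuantumFields.BalabanUV.Beta.SymmetrisedDressingMatrix (pmSymBm)
open Summit.QuantumFields.BalabanUV.Beta.SymmetrisedDressingKernel (piKSymBm piKSymBm_inl_inl piKSymBm_inl_inr piKSymBm_inr_inl piKSymBm_inr_inr
  sum_piKSymBm_col_inl coDressKSymAt coDressKSymAt_eq comp_piKSymBm_inr decays_coDressKSymAt)
open Summit.QuantumFields.BalabanUV.Beta.SymmetrisedStepJets (Gsym Gsym_apply)
open Summit.QuantumFields.BalabanUV.Beta.GAN24.CombesThomas (KStepUnit sfStep smStep)
open Summit.QuantumFields.BalabanUV.Beta.GAN24.KSlotAssembly (convCKWall_holds)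
open Summit.QuantumFields.BalabanUV.Beta.FP.PerfectObjectsT (KPerf KPerf_one)
open Summit.QuantumFields.BalabanUV.Beta.FP.SymmetryKHolds (tendsto_KStepUnit_KPerf_one decays_KPerf_one_holds)
open Summit.QuantumFields.BalabanUV.Beta.FP.SymDressingUnits (coDressKSymAt_unitK coDressKSymAt_sub decays_coDressKSymAt_explicit
  limMKerOf_coDressKSymAt_unitK_eq)

variable {d : ℕ}

/-! ## §1 Finite-window readings of the two factors; entrywise limits pass through the co-dressing (letter-free) -/

section Window

variable (ρ : Fin (d + 1) → ℤ) (N : ℕ)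

/-- [folklore] LEFT FACTOR, MULTIPLIER ROW: `(piKSymBmᵀ ∘ K) x y (inr m) b = K x y (inr m) b` (the multiplier block of `piKSymBm` is the identity). -/
theorem comp_trK_piKSymBm_inr (K : MKer (d + 1) (Fib d)) (x y : Fin (d + 1) → ℤ) (m : Fin (d + 1)) (b : Fib d) :
    comp (trK (piKSymBm ρ N)) K x y (Sum.inr m) b = K x y (Sum.inr m) b := by
  unfold ExpKernelCalculus.comp
  have h : ∀ z, ∑ f : Fib d, trK (piKSymBm ρ N) x z (Sum.inr m) f * K z y f b = if z = x then K z y (Sum.inr m) b else 0 := by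
    intro z
    rw [Fintype.sum_sum_type]
    simp only [trK_apply, piKSymBm_inl_inr, zero_mul, Finset.sum_const_zero, zero_add, piKSymBm_inr_inr]
    by_cases hz : z = x
    · subst hz
      simp only [true_and, ite_mul, one_mul, zero_mul, Finset.sum_ite_eq', Finset.mem_univ, if_true]
    · simp [hz]
  simp_rw [h]
  exact tsum_point' x fun z => K z y (Sum.inr m) b

/-- [folklore] LEFT FACTOR, FIELD ROW: `(piKSymBmᵀ ∘ K) x y (inl α) b = Σ_{v ∈ cube} Σ_κ pmSymBm ρ N α x κ (x − v) · K (x − v) y (inl κ) b` — a FINITE window sum. -/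
theorem comp_trK_piKSymBm_inl (K : MKer (d + 1) (Fib d)) (x y : Fin (d + 1) → ℤ) (α : Fin (d + 1)) (b : Fib d) :
    comp (trK (piKSymBm ρ N)) K x y (Sum.inl α) b =
      ∑ v ∈ cube (d + 1) N, ∑ κ : Fin (d + 1), pmSymBm ρ N α x κ (x - v) * K (x - v) y (Sum.inl κ) b := by
  unfold ExpKernelCalculus.comp
  have h : ∀ z, ∑ f : Fib d, trK (piKSymBm ρ N) x z (Sum.inl α) f * K z y f b =
      if x - z ∈ cube (d + 1) N then ∑ κ : Fin (d + 1), pmSymBm ρ N α x κ z * K z y (Sum.inl κ) b else 0 := by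
    intro z
    simp only [trK_apply]
    exact sum_piKSymBm_col_inl ρ N z x α (fun f => K z y f b)
  simp_rw [h]
  exact tsum_window' N x fun z => ∑ κ : Fin (d + 1), pmSymBm ρ N α x κ z * K z y (Sum.inl κ) b

/-- [folklore] RIGHT FACTOR, FIELD COLUMN: `(A ∘ piKSymBm) x y a (inl β) = Σ_{v ∈ cube} Σ_κ A x (y − v) a (inl κ) · pmSymBm ρ N β y κ (y − v)` — a FINITE window sum
(the multiplier column is an2's `SymmetrisedDressingKernel.comp_piKSymBm_inr`). -/
theorem comp_piKSymBm_inl (A : MKer (d + 1) (Fib d)) (x y : Fin (d + 1) → ℤ) (a : Fib d) (β : Fin (d + 1)) :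
    comp A (piKSymBm ρ N) x y a (Sum.inl β) =
      ∑ v ∈ cube (d + 1) N, ∑ κ : Fin (d + 1), A x (y - v) a (Sum.inl κ) * pmSymBm ρ N β y κ (y - v) := by
  unfold ExpKernelCalculus.comp
  have h : ∀ z, ∑ f : Fib d, A x z a f * piKSymBm ρ N z y f (Sum.inl β) =
      if y - z ∈ cube (d + 1) N then ∑ κ : Fin (d + 1), A x z a (Sum.inl κ) * pmSymBm ρ N β y κ z else 0 := by
    intro z
    rw [Fintype.sum_sum_type]
    simp only [piKSymBm_inl_inl, piKSymBm_inr_inl, mul_zero, Finset.sum_const_zero, add_zero]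
    split_ifs with hz
    · rfl
    · simp
  simp_rw [h]
  exact tsum_window' N y fun z => ∑ κ : Fin (d + 1), A x z a (Sum.inl κ) * pmSymBm ρ N β y κ z

/-- [folklore] Entrywise limits pass through the LEFT factor `piKSymBmᵀ ∘ ·` (finite sums and products of convergent real sequences; NO letter on `K`). -/
theorem tendsto_comp_trK_piKSymBm {K : ℕ → MKer (d + 1) (Fib d)} {L : MKer (d + 1) (Fib d)}
    (hK : ∀ x y a b, Tendsto (fun j => K j x y a b) atTop (𝓝 (L x y a b))) (x y : Fin (d + 1) → ℤ) (a b : Fib d) :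
    Tendsto (fun j => comp (trK (piKSymBm ρ N)) (K j) x y a b) atTop (𝓝 (comp (trK (piKSymBm ρ N)) L x y a b)) := by
  rcases a with α | m
  · simp only [comp_trK_piKSymBm_inl]
    exact tendsto_finsetSum _ fun v _ => tendsto_finsetSum _ fun κ _ => (hK _ _ _ _).const_mul _
  · simp only [comp_trK_piKSymBm_inr]
    exact hK _ _ _ _

/-- [folklore] **ENTRYWISE LIMITS PASS THROUGH THE SYMMETRISED CO-DRESSING** (any `d`, root `ρ`, blocking `N`; NO decay or summability letter on the family):
if `K j → L` entrywise then `coDressKSymAt ρ N (K j) → coDressKSymAt ρ N L` entrywise. -/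
theorem tendsto_coDressKSymAt {K : ℕ → MKer (d + 1) (Fib d)} {L : MKer (d + 1) (Fib d)}
    (hK : ∀ x y a b, Tendsto (fun j => K j x y a b) atTop (𝓝 (L x y a b))) (x y : Fin (d + 1) → ℤ) (a b : Fib d) :
    Tendsto (fun j => coDressKSymAt ρ N (K j) x y a b) atTop (𝓝 (coDressKSymAt ρ N L x y a b)) := by
  have h1 := tendsto_comp_trK_piKSymBm ρ N hK
  simp only [coDressKSymAt_eq]
  rcases b with β | μ
  · simp only [comp_piKSymBm_inl]
    exact tendsto_finsetSum _ fun v _ => tendsto_finsetSum _ fun κ _ => (h1 _ _ _ _).mul_const _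
  · simp only [comp_piKSymBm_inr]
    exact h1 _ _ _ _

/-- [folklore] **THE SYMMETRISED CO-DRESSING COMMUTES WITH THE CONSTRUCTED LIMIT**: if `K j → L` entrywise then
`limMKerOf (j ↦ coDressKSymAt ρ N (K j)) = coDressKSymAt ρ N L` (`HessKerDressedLimit.limMKerOf_eq_of_tendsto`; the letter-free twin of the owner's `SymDressingUnits.limMKerOf_coDressKSymAt_eq`). -/
theorem limMKerOf_coDressKSymAt {K : ℕ → MKer (d + 1) (Fib d)} {L : MKer (d + 1) (Fib d)}
    (hK : ∀ x y a b, Tendsto (fun j => K j x y a b) atTop (𝓝 (L x y a b))) :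
    limMKerOf (fun j => coDressKSymAt ρ N (K j)) = coDressKSymAt ρ N L :=
  limMKerOf_eq_of_tendsto (tendsto_coDressKSymAt ρ N hK)

/-- [folklore] … equivalently `limMKerOf (j ↦ coDressKSymAt ρ N (K j)) = coDressKSymAt ρ N (limMKerOf K)` for every entrywise convergent family. -/
theorem limMKerOf_coDressKSymAt_lim {K : ℕ → MKer (d + 1) (Fib d)} {L : MKer (d + 1) (Fib d)}
    (hK : ∀ x y a b, Tendsto (fun j => K j x y a b) atTop (𝓝 (L x y a b))) :
    limMKerOf (fun j => coDressKSymAt ρ N (K j)) = coDressKSymAt ρ N (limMKerOf K) := by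
  rw [limMKerOf_coDressKSymAt ρ N hK, limMKerOf_eq_of_tendsto hK]

end Window

/-! ## §2 The rows transfer for the symmetrised co-dressing, CAUCHY currency (in-block root; over the owner's linearity and displayed-constant decay) -/

section Transport

variable {N : ℕ} (hN : 1 ≤ N) {r : Fin (d + 1) → ℕ} (hr : r ∈ box (d + 1) N)
include hN hr

/-- [folklore] **UNIFORM DECAY TRANSPORT THROUGH THE SYMMETRISED CO-DRESSING**, `∃`-packaged: for every `δ > 0` there is `c = c(d,N,δ) ≥ 0` with
`Decays K C δ → Decays (coDressKSymAt (toSite r) N K) (c·C) (δ/4)` for ALL `K`, `C` — the owner's `SymDressingUnits.decays_coDressKSymAt_explicit` (constant displayed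
there) with the `C`-linear constant factored out; twin of asym1's `HessKerCoDressedBmWall.exists_decays_coDressKBmAt`. -/
theorem exists_decays_coDressKSymAt_uniform {δ : ℝ} (hδ : 0 < δ) :
    ∃ c : ℝ, 0 ≤ c ∧ ∀ (K : MKer (d + 1) (Fib d)) (C : ℝ), Decays K C δ → Decays (coDressKSymAt (toSite r) N K) (c * C) (δ / 4) := by
  refine ⟨(Fintype.card (Fib d) : ℝ) * ((Fintype.card (Fib d) : ℝ) * cPb d N δ * Zl (d + 1) (δ - δ / 2) * cPb d N (δ / 2)) * Zl (d + 1) (δ / 2 - δ / 4),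
    mul_nonneg (mul_nonneg (Nat.cast_nonneg _) (mul_nonneg (mul_nonneg (mul_nonneg (Nat.cast_nonneg _) (cPb_nonneg d N δ))
      (Zl_nonneg (by linarith))) (cPb_nonneg d N (δ / 2)))) (Zl_nonneg (by linarith)), fun K C hK => ?_⟩
  have h := decays_coDressKSymAt_explicit hN hr hδ hK
  refine fun x y a b => (h x y a b).trans (le_of_eq ?_)
  ring

/-- [folklore] **FAMILY ROWS TRANSFER TO THE SYMMETRISED CO-DRESSED FAMILY, CAUCHY CURRENCY**: `j`-uniform rows and ALL-SCALES deviations (`δK > 0`) of `K`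
give those of `j ↦ coDressKSymAt (toSite r) N (K j)` at `(c·C, δK/4)` and `(c·c_K·θ^k, δK/4)`, `c = c(d,N,δK)` (the owner's `coDressKSymAt_sub` + §2's transport). -/
theorem exists_coDressedSym_rows {K : ℕ → MKer (d + 1) (Fib d)} {C cK δK θ : ℝ} (hδK : 0 < δK) (hK : ∀ j, Decays (K j) C δK)
    (hKall : ∀ k j, Decays (K (k + j) - K k) (cK * θ ^ k) δK) :
    ∃ c : ℝ, 0 ≤ c ∧ (∀ j, Decays (coDressKSymAt (toSite r) N (K j)) (c * C) (δK / 4)) ∧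
      ∀ k j, Decays (coDressKSymAt (toSite r) N (K (k + j)) - coDressKSymAt (toSite r) N (K k)) (c * cK * θ ^ k) (δK / 4) := by
  obtain ⟨c, hc0, hc⟩ := exists_decays_coDressKSymAt_uniform hN hr hδK
  refine ⟨c, hc0, fun j => hc _ _ (hK j), fun k j => ?_⟩
  rw [← coDressKSymAt_sub hN hr ⟨C, δK, hδK, hK (k + j)⟩ ⟨C, δK, hδK, hK k⟩, mul_assoc]
  exact hc _ _ (hKall k j)

/-- [folklore] **RESCALED FAMILY ROWS TRANSFER TO THE RESCALED SYMMETRISED CO-DRESSED FAMILY** (any leg units — the owner's hypothesis-free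
`coDressKSymAt_unitK`): rows and all-scales deviations of `D_j K_j D_j` give those of `D_j (coDressKSymAt (toSite r) N K_j) D_j` at `(c·C, δK/4, c·c_K, θ)`
(sym twin of asym1's `HessKerCoDressedBmWall.exists_coDressedBm_unit_rows`). -/
theorem exists_coDressedSym_unit_rows (sf sm : ℕ → ℝ) {K : ℕ → MKer (d + 1) (Fib d)}
    {C cK δK θ : ℝ} (hδK : 0 < δK) (hK : ∀ j, Decays (unitK (sf j) (sm j) (K j)) C δK)
    (hKall : ∀ k j, Decays (unitK (sf (k + j)) (sm (k + j)) (K (k + j)) - unitK (sf k) (sm k) (K k)) (cK * θ ^ k) δK) :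
    ∃ c : ℝ, 0 ≤ c ∧ (∀ j, Decays (unitK (sf j) (sm j) (coDressKSymAt (toSite r) N (K j))) (c * C) (δK / 4)) ∧
      ∀ k j, Decays (unitK (sf (k + j)) (sm (k + j)) (coDressKSymAt (toSite r) N (K (k + j))) -
        unitK (sf k) (sm k) (coDressKSymAt (toSite r) N (K k))) (c * cK * θ ^ k) (δK / 4) := by
  obtain ⟨c, hc0, h1, h2⟩ := exists_coDressedSym_rows hN hr (K := fun j => unitK (sf j) (sm j) (K j)) hδK hK hKall
  refine ⟨c, hc0, fun j => ?_, fun k j => ?_⟩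
  · rw [← coDressKSymAt_unitK]
    exact h1 j
  · rw [← coDressKSymAt_unitK, ← coDressKSymAt_unitK]
    exact h2 k j

end Transport

/-! ## §3 Dimension four, UNCONDITIONAL: the perfect co-dressed one-step resolvent IS the co-dressing of the perfect one-step resolvent -/

section DimFour

variable {Lc : ℕ} [NeZero Lc]

/-- [our object] **THE UNIT-RESCALED CO-DRESSED STEP RESOLVENTS CONVERGE ENTRYWISE TO THE CO-DRESSING OF THE PERFECT ONE-STEP RESOLVENT** (`d = 3`, every
`Lc ≥ 2`, every root `ρ`; no hypothesis): `unitK (sfStep Lc j) (smStep 3 Lc j) (coDressKSymAt ρ Lc (KInvStep Lc j)) → coDressKSymAt ρ Lc (KPerf Lc (sfStep Lc) (smStep 3 Lc) 1)`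
entrywise — the owner's `coDressKSymAt_unitK` (units inside) + §1 (limits pass, letter-free) over `SymmetryKHolds.tendsto_KStepUnit_KPerf_one` (X1-K at `m = 1`,
gan24's `convCKWall_holds`). -/
theorem tendsto_unitK_coDressKSymAt_KInvStep (hLc : 2 ≤ Lc) (ρ : Fin (3 + 1) → ℤ) (x y : Fin (3 + 1) → ℤ) (a b : Fib 3) :
    Tendsto (fun j => unitK (sfStep Lc j) (smStep 3 Lc j) (coDressKSymAt ρ Lc (KInvStep (d := 3) Lc j)) x y a b) atTop
      (𝓝 (coDressKSymAt ρ Lc (KPerf (d := 3) Lc (sfStep Lc) (smStep 3 Lc) 1) x y a b)) := by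
  have h := tendsto_coDressKSymAt ρ Lc (K := fun j => KStepUnit (d := 3) Lc j) (tendsto_KStepUnit_KPerf_one hLc) x y a b
  refine h.congr' (Eventually.of_forall fun j => ?_)
  show coDressKSymAt ρ Lc (unitK (sfStep Lc j) (smStep 3 Lc j) (KInvStep (d := 3) Lc j)) x y a b =
    unitK (sfStep Lc j) (smStep 3 Lc j) (coDressKSymAt ρ Lc (KInvStep (d := 3) Lc j)) x y a b
  rw [coDressKSymAt_unitK]

/-- [our object] **KPERF-SYM (R-FP-40 row #16), GENERIC ROOT**: `limMKerOf (j ↦ unitK (sfStep Lc j) (smStep 3 Lc j) (coDressKSymAt ρ Lc (KInvStep Lc j)))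
= coDressKSymAt ρ Lc (KPerf Lc (sfStep Lc) (smStep 3 Lc) 1)` — `d = 3`, every `Lc ≥ 2`, every root `ρ`, UNCONDITIONAL. -/
theorem limMKerOf_unitK_coDressKSymAt_KInvStep (hLc : 2 ≤ Lc) (ρ : Fin (3 + 1) → ℤ) :
    limMKerOf (fun j => unitK (sfStep Lc j) (smStep 3 Lc j) (coDressKSymAt ρ Lc (KInvStep (d := 3) Lc j))) =
      coDressKSymAt ρ Lc (KPerf (d := 3) Lc (sfStep Lc) (smStep 3 Lc) 1) :=
  limMKerOf_eq_of_tendsto (tendsto_unitK_coDressKSymAt_KInvStep hLc ρ)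


/-- [our object] **THE SAME IDENTITY THROUGH THE OWNER's ROUTE** (in-block root): `SymDressingUnits.limMKerOf_coDressKSymAt_unitK_eq` with ALL FOUR of its data —
uniform decay of `unitK_j (KInvStep Lc j)`, decay of `KPerf … 1`, the `Decays`-rate `unitK_j (KInvStep Lc j) → KPerf … 1`, `0 ≤ θ < 1` — DISCHARGED at `d = 3` by
gan24's `convCKWall_holds` and asym1's closure lemmas `decays_limMKerOf`∕`decays_sub_limMKerOf` (`KPerf_one` is `rfl`): the owner's «✓⊙ modulo (CONV-C) rate data»
is «✓» for the K-slot, and the two routes (§1 finite window ∕ owner's rate transfer) agree BY NAME. -/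
theorem limMKerOf_unitK_coDressKSymAt_KInvStep_of_owner (hLc : 2 ≤ Lc) {r : Fin (3 + 1) → ℕ} (hr : r ∈ box (3 + 1) Lc) :
    limMKerOf (fun j => unitK (sfStep Lc j) (smStep 3 Lc j) (coDressKSymAt (toSite r) Lc (KInvStep (d := 3) Lc j))) =
      coDressKSymAt (toSite r) Lc (KPerf (d := 3) Lc (sfStep Lc) (smStep 3 Lc) 1) := by
  obtain ⟨C, δ, cK, θ, hδ, hθ0, hθ1, hK, hKall⟩ := convCKWall_holds hLc
  have hKinf : Decays (KPerf (d := 3) Lc (sfStep Lc) (smStep 3 Lc) 1) C δ := by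
    rw [KPerf_one]
    exact decays_limMKerOf hK hKall hθ1
  have hrate : ∀ j, Decays (unitK (sfStep Lc j) (smStep 3 Lc j) (KInvStep (d := 3) Lc j) - KPerf (d := 3) Lc (sfStep Lc) (smStep 3 Lc) 1) (cK * θ ^ j) δ := by
    intro j
    rw [KPerf_one]
    exact decays_sub_limMKerOf (K := fun j => unitK (sfStep Lc j) (smStep 3 Lc j) (KInvStep (d := 3) Lc j)) hKall hθ1 j
  exact limMKerOf_coDressKSymAt_unitK_eq (one_le_of_neZero Lc) hr (K := fun j => KInvStep (d := 3) Lc j) (sfStep Lc) (smStep 3 Lc) hδ hK hKinf hrate hθ0 hθ1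

/-- [our object] **KPERF-SYM AT an2's CENTRED FAMILY `Gsym`** (THE ROW's `G^s_1`, named as the constructed limit and identified; no new `def`):
`limMKerOf (j ↦ unitK (sfStep Lc j) (smStep 3 Lc j) (Gsym Lc j)) = coDressKSymAt (ctr 4 Lc) Lc (KPerf Lc (sfStep Lc) (smStep 3 Lc) 1)`, `d = 3`, every `Lc ≥ 2`. -/
theorem limMKerOf_unitK_Gsym (hLc : 2 ≤ Lc) :
    limMKerOf (fun j => unitK (sfStep Lc j) (smStep 3 Lc j) (Gsym (d := 3) Lc j)) =
      coDressKSymAt (ctr (3 + 1) Lc) Lc (KPerf (d := 3) Lc (sfStep Lc) (smStep 3 Lc) 1) := by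
  have e : (fun j => unitK (sfStep Lc j) (smStep 3 Lc j) (Gsym (d := 3) Lc j)) =
      fun j => unitK (sfStep Lc j) (smStep 3 Lc j) (coDressKSymAt (ctr (3 + 1) Lc) Lc (KInvStep (d := 3) Lc j)) := by
    funext j; rw [Gsym_apply]
  rw [e]
  exact limMKerOf_unitK_coDressKSymAt_KInvStep hLc _

/-- [our object] … with the entrywise convergence statement at `Gsym`. -/
theorem tendsto_unitK_Gsym (hLc : 2 ≤ Lc) (x y : Fin (3 + 1) → ℤ) (a b : Fib 3) :
    Tendsto (fun j => unitK (sfStep Lc j) (smStep 3 Lc j) (Gsym (d := 3) Lc j) x y a b) atTop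
      (𝓝 (coDressKSymAt (ctr (3 + 1) Lc) Lc (KPerf (d := 3) Lc (sfStep Lc) (smStep 3 Lc) 1) x y a b)) := by
  simp only [Gsym_apply]
  exact tendsto_unitK_coDressKSymAt_KInvStep hLc _ x y a b

/-- [our object] **THE CO-DRESSED UNIT FAMILY's K-ROWS `hK`∕`hKall`, UNCONDITIONAL** (`d = 3`, `2 ≤ Lc`, in-block root `toSite r`): from gan24's
`KSlotAssembly.convCKWall_holds` through §2 — `∃ C δ cK θ, 0 < δ ∧ 0 ≤ θ ∧ θ < 1 ∧ (∀ j, Decays (D_j G_j D_j) C δ) ∧ ∀ k j, Decays (D_{k+j} G_{k+j} D_{k+j} − D_k G_k D_k) (cK·θ^k) δ`,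
`G_j := coDressKSymAt (toSite r) Lc (KInvStep Lc j)`.  (The WALL-SYM END that would consume these rows is row #18 — NOT here.) -/
theorem kSlotSym_holds (hLc : 2 ≤ Lc) {r : Fin (3 + 1) → ℕ} (hr : r ∈ box (3 + 1) Lc) :
    ∃ C δ cK θ : ℝ, 0 < δ ∧ 0 ≤ θ ∧ θ < 1 ∧
      (∀ j, Decays (unitK (sfStep Lc j) (smStep 3 Lc j) (coDressKSymAt (toSite r) Lc (KInvStep (d := 3) Lc j))) C δ) ∧
      ∀ k j, Decays (unitK (sfStep Lc (k + j)) (smStep 3 Lc (k + j)) (coDressKSymAt (toSite r) Lc (KInvStep (d := 3) Lc (k + j))) -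
        unitK (sfStep Lc k) (smStep 3 Lc k) (coDressKSymAt (toSite r) Lc (KInvStep (d := 3) Lc k))) (cK * θ ^ k) δ := by
  obtain ⟨C, δ, cK, θ, hδ, hθ0, hθ1, hK, hKall⟩ := convCKWall_holds hLc
  obtain ⟨c, -, h1, h2⟩ := exists_coDressedSym_unit_rows (d := 3) (one_le_of_neZero Lc) hr (sfStep Lc) (smStep 3 Lc)
    (K := fun j => KInvStep (d := 3) Lc j) hδ hK hKall
  exact ⟨c * C, δ / 4, c * cK, θ, by linarith, hθ0, hθ1, h1, h2⟩

/-- [our object] … at an2's CENTRED root `ctr 4 Lc = toSite (ctrOff 4 Lc)` (the root of `Gsym`): the rows of `j ↦ unitK_j (Gsym Lc j)`. -/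
theorem kSlotSym_ctr_holds (hLc : 2 ≤ Lc) :
    ∃ C δ cK θ : ℝ, 0 < δ ∧ 0 ≤ θ ∧ θ < 1 ∧
      (∀ j, Decays (unitK (sfStep Lc j) (smStep 3 Lc j) (Gsym (d := 3) Lc j)) C δ) ∧
      ∀ k j, Decays (unitK (sfStep Lc (k + j)) (smStep 3 Lc (k + j)) (Gsym (d := 3) Lc (k + j)) -
        unitK (sfStep Lc k) (smStep 3 Lc k) (Gsym (d := 3) Lc k)) (cK * θ ^ k) δ := by
  simp only [Gsym_apply]
  exact kSlotSym_holds hLc (ctrOff_mem_box (one_le_of_neZero Lc))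

/-- [our object] **GEOMETRIC `Decays`-RATE OF THE UNIT CO-DRESSED FAMILY TO THE CO-DRESSED PERFECT RESOLVENT** (`d = 3`, `2 ≤ Lc`; constant and rate from
`kSlotSym_ctr_holds`, SAME constant — `HessKerDressedLimit.decays_sub_limMKerOf` + the identification `limMKerOf_unitK_Gsym`). -/
theorem decays_unitK_Gsym_sub_holds (hLc : 2 ≤ Lc) :
    ∃ δ cK θ : ℝ, 0 < δ ∧ 0 ≤ θ ∧ θ < 1 ∧
      ∀ k, Decays (unitK (sfStep Lc k) (smStep 3 Lc k) (Gsym (d := 3) Lc k) -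
        coDressKSymAt (ctr (3 + 1) Lc) Lc (KPerf (d := 3) Lc (sfStep Lc) (smStep 3 Lc) 1)) (cK * θ ^ k) δ := by
  obtain ⟨C, δ, cK, θ, hδ, hθ0, hθ1, -, hGall⟩ := kSlotSym_ctr_holds hLc
  refine ⟨δ, cK, θ, hδ, hθ0, hθ1, fun k => ?_⟩
  rw [← limMKerOf_unitK_Gsym hLc]
  exact decays_sub_limMKerOf (K := fun j => unitK (sfStep Lc j) (smStep 3 Lc j) (Gsym (d := 3) Lc j)) hGall hθ1 k

/-- [our object] **THE CO-DRESSED PERFECT ONE-STEP RESOLVENT DECAYS** (`d = 3`, `2 ≤ Lc`, in-block root): an2's `decays_coDressKSymAt` at the lineage's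
`SymmetryKHolds.decays_KPerf_one_holds`. -/
theorem exists_decays_coDressKSymAt_KPerf_one (hLc : 2 ≤ Lc) {r : Fin (3 + 1) → ℕ} (hr : r ∈ box (3 + 1) Lc) :
    ∃ δ C : ℝ, 0 < δ ∧ 0 ≤ C ∧ Decays (coDressKSymAt (toSite r) Lc (KPerf (d := 3) Lc (sfStep Lc) (smStep 3 Lc) 1)) C δ :=
  decays_coDressKSymAt (one_le_of_neZero Lc) hr (decays_KPerf_one_holds hLc)

end DimFour

end Summit.QuantumFields.BalabanUV.Beta.FP.KPerfSymHolds

end
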